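import Summits.CriticalPhenomena.SAWScalingLimit.Theses.SAWSchrammPassage

/-!
# Birth skeleton — crux `ArcBoundaryValues` (stmt-CriticalPhenomena-17592)

Piece 2/3 of the strategist's typed split of the deciding crux `ClosureToSchramm`
(stmt-CriticalPhenomena-5597, route SAWSchrammPassage; glue `ClosureToSchrammOfPieces`, stmt-17594).
Two registered stubs — the two one-sided BOUNDARY-PROXIMITY (Beurling-type) estimates of the critical
SAW, one per boundary arc — and the kernel-checked composition `ArcBoundaryValues_of`:

* `stub_nearArcZero` (LOAD-BEARING, open): if `x` has `N(e)` cells of room and is conformally adjacent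
  to the arc `Φ(ℝ₊)` (`arg Φ⁻¹x ≤ η(e)`), the walk separates `x` from that arc with probability `≤ e`:
  `|h_δ(x) − (1 − index_D x)/2| ≤ e` (LawlerSchrammWerner2004SAW; the SLE(8/3) boundary exponent is 2).
* `stub_nearArcPi` (open): the same at the arc `Φ(ℝ₋)` (`π − η ≤ arg Φ⁻¹x`): `|h_δ(x) − (1 + index_D x)/2| ≤ e`.
  (The two are exchanged by complex conjugation of the configuration, which maps cell domains to cell
  domains and reverses the orientation; no formal reduction is claimed here.)
* `ArcBoundaryValues_of` (PROVED): Schramm's value `(1 − index·cos arg Φ⁻¹x)/2` is within `e/2` of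
  `(1 ∓ index)/2` when `arg ≤ η₂(e)` resp. `≥ π − η₂(e)` (`1 − cos θ ≤ θ²/2`, `index = ±1` by
  `JordanDomain.index_eq_one_or_eq_neg_one`, `cos arg = Re/‖·‖` by `Complex.cos_arg`), so the halves at
  tolerance `e/2` give the crux with `η = min(η₀, η₁, η₂)`, `N = max(N₀, N₁)`.
-/

noncomputable section

open MeasureTheory Set
open Literature.Probability.LatticeModels Literature.Probability.RandomPlanarGeometry
open Literature.Topology.PlaneTopology
open Summit.CriticalPhenomena.SAWScalingLimit.Theses.SAWSchrammPassage (ArcBoundaryValues)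

set_option linter.dupNamespace false

namespace Summit.CriticalPhenomena.SAWScalingLimit.Cruxes.ArcBoundaryValues.Birth

/-! ## Statements -/

/-- Boundary proximity at the arc `Φ(ℝ₊)` (statement of `stub_nearArcZero`). [conjecture] -/
def NearArcZero : Prop :=
  ∀ e > (0 : ℝ), ∃ η > (0 : ℝ), ∃ N : ℕ, ∀ (δ : ℝ) (S : Finset (Literature.Probability.LatticeModels.Site 2)) (p p' q q' : Literature.Probability.LatticeModels.Site 2) (D : Literature.Probability.RandomPlanarGeometry.DobrushinDomain) (Φ : Literature.Probability.RandomPlanarGeometry.ConformalEquiv UpperHalfPlane.upperHalfPlaneSet D.carrier) (x : ℂ), let L : Literature.Probability.RandomPlanarGeometry.SAW.DomainSAW D.carrier δ p q → ℝ → ℂ := fun γ t => if t ≤ 1 / 2 then (γ.walk.toCurve (Literature.Probability.LatticeModels.meshPoint δ)) (Set.projIcc (0 : ℝ) 1 zero_le_one (2 * t)) else if 2 * t - 1 ≤ 1 / 3 then Literature.Probability.LatticeModels.meshPoint δ q + ((3 * (2 * t - 1) : ℝ) : ℂ) * (D.pt 1 - Literature.Probability.LatticeModels.meshPoint δ q)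 else if 2 * t - 1 ≤ 2 / 3 then D.boundary (D.mark 1 + (3 * (2 * t - 1) - 1) * (D.mark 0 + 1 - D.mark 1)) else D.pt 0 + ((3 * (2 * t - 1) - 2 : ℝ) : ℂ) * (Literature.Probability.LatticeModels.meshPoint δ p - D.pt 0); 0 < δ → p ∈ S → q ∈ S → p' ∉ S → q' ∉ S → (Literature.Probability.LatticeModels.zdGraph 2).Adj p p' → (Literature.Probability.LatticeModels.zdGraph 2).Adj q q' → D.carrier = interior ({w : ℂ | ∃ v ∈ S, |w.re - (Literature.Probability.LatticeModels.meshPoint δ v).re| ≤ δ / 2 ∧ |w.im - (Literature.Probability.LatticeModels.meshPoint δ v).im| ≤ δ / 2 ∧ |w.re - (Literature.Probability.LatticeModels.meshPoint δ v).re| + |w.im - (Literature.Probability.LatticeModels.meshPoint δ v).im| ≤ 9 * δ / 10} ∪ {w : ℂ | ∃ v ∈ S, v + ![1, 0] ∈ S ∧ v + ![0, 1] ∈ S ∧ v + ![1, 1] ∈ S ∧ |w.re - (Literature.Probability.LatticeModels.meshPoint δ v).re - δ / 2| + |w.im - (Literature.Probability.LatticeModels.meshPoint δ v).im - δ / 2|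 ≤ δ / 10}) → D.pt 0 = (Literature.Probability.LatticeModels.meshPoint δ p + Literature.Probability.LatticeModels.meshPoint δ p') / 2 → D.pt 1 = (Literature.Probability.LatticeModels.meshPoint δ q + Literature.Probability.LatticeModels.meshPoint δ q') / 2 → D.IsChordalUniformizing Φ → x ∈ D.carrier → (N : ℝ) * δ ≤ Metric.infDist x D.carrierᶜ → Complex.arg (Φ.symm x) ≤ η → |(Literature.Probability.RandomPlanarGeometry.SAW.law D.carrier δ p q {γ | Literature.Topology.PlaneTopology.wind (fun t => L γ t - x) ≠ 0}).toReal - (1 - (D.index x : ℝ)) / 2| ≤ e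

/-- Boundary proximity at the arc `Φ(ℝ₋)` (statement of `stub_nearArcPi`). [conjecture] -/
def NearArcPi : Prop :=
  ∀ e > (0 : ℝ), ∃ η > (0 : ℝ), ∃ N : ℕ, ∀ (δ : ℝ) (S : Finset (Literature.Probability.LatticeModels.Site 2)) (p p' q q' : Literature.Probability.LatticeModels.Site 2) (D : Literature.Probability.RandomPlanarGeometry.DobrushinDomain) (Φ : Literature.Probability.RandomPlanarGeometry.ConformalEquiv UpperHalfPlane.upperHalfPlaneSet D.carrier) (x : ℂ), let L : Literature.Probability.RandomPlanarGeometry.SAW.DomainSAW D.carrier δ p q → ℝ → ℂ := fun γ t => if t ≤ 1 / 2 then (γ.walk.toCurve (Literature.Probability.LatticeModels.meshPoint δ)) (Set.projIcc (0 : ℝ) 1 zero_le_one (2 * t)) else if 2 * t - 1 ≤ 1 / 3 then Literature.Probability.LatticeModels.meshPoint δ q + ((3 * (2 * t - 1) : ℝ) : ℂ) * (D.pt 1 - Literature.Probability.LatticeModels.meshPoint δ q) else if 2 * t - 1 ≤ 2 / 3 then D.boundary (D.mark 1 + (3 * (2 * t - 1) - 1) * (D.mark 0 + 1 - D.mark 1))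 else D.pt 0 + ((3 * (2 * t - 1) - 2 : ℝ) : ℂ) * (Literature.Probability.LatticeModels.meshPoint δ p - D.pt 0); 0 < δ → p ∈ S → q ∈ S → p' ∉ S → q' ∉ S → (Literature.Probability.LatticeModels.zdGraph 2).Adj p p' → (Literature.Probability.LatticeModels.zdGraph 2).Adj q q' → D.carrier = interior ({w : ℂ | ∃ v ∈ S, |w.re - (Literature.Probability.LatticeModels.meshPoint δ v).re| ≤ δ / 2 ∧ |w.im - (Literature.Probability.LatticeModels.meshPoint δ v).im| ≤ δ / 2 ∧ |w.re - (Literature.Probability.LatticeModels.meshPoint δ v).re| + |w.im - (Literature.Probability.LatticeModels.meshPoint δ v).im| ≤ 9 * δ / 10} ∪ {w : ℂ | ∃ v ∈ S, v + ![1, 0] ∈ S ∧ v + ![0, 1] ∈ S ∧ v + ![1, 1] ∈ S ∧ |w.re - (Literature.Probability.LatticeModels.meshPoint δ v).re - δ / 2| + |w.im - (Literature.Probability.LatticeModels.meshPoint δ v).im - δ / 2| ≤ δ / 10}) → D.pt 0 = (Literature.Probability.LatticeModels.meshPoint δ p + Literature.Probability.LatticeModels.meshPoint δ p') / 2 → D.pt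 1 = (Literature.Probability.LatticeModels.meshPoint δ q + Literature.Probability.LatticeModels.meshPoint δ q') / 2 → D.IsChordalUniformizing Φ → x ∈ D.carrier → (N : ℝ) * δ ≤ Metric.infDist x D.carrierᶜ → Real.pi - η ≤ Complex.arg (Φ.symm x) → |(Literature.Probability.RandomPlanarGeometry.SAW.law D.carrier δ p q {γ | Literature.Topology.PlaneTopology.wind (fun t => L γ t - x) ≠ 0}).toReal - (1 + (D.index x : ℝ)) / 2| ≤ e

/-! ## Stubs (the only `sorry`s) -/

/-- **Stub (load-bearing): boundary proximity at the arc `Φ(ℝ₊)`.** [conjecture] -/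
theorem stub_nearArcZero : NearArcZero := by
  sorry

/-- **Stub: boundary proximity at the arc `Φ(ℝ₋)`.** [conjecture] -/
theorem stub_nearArcPi : NearArcPi := by
  sorry

namespace __Registered

/-- Alias of `NearArcZero` keyed by the registered stub name. -/
abbrev stub_nearArcZero : Prop := NearArcZero
/-- Alias of `NearArcPi` keyed by the registered stub name. -/
abbrev stub_nearArcPi : Prop := NearArcPi

end __Registered

/-- `1 - cos θ ≤ θ²/2 ≤ e` for `|θ| ≤ min 1 e`. [folklore] -/
theorem one_sub_cos_le {θ e : ℝ} (he : 0 < e) (hθ : |θ| ≤ min 1 e) : 1 - Real.cos θ ≤ e := by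
  have h1 : |θ| ≤ 1 := hθ.trans (min_le_left _ _)
  have h2 : |θ| ≤ e := hθ.trans (min_le_right _ _)
  have h3 : θ ^ 2 ≤ e := by
    calc θ ^ 2 = |θ| * |θ| := by rw [← sq_abs]; ring
      _ ≤ 1 * e := mul_le_mul h1 h2 (abs_nonneg _) zero_le_one
      _ = e := one_mul e
  have h4 := Real.one_sub_sq_div_two_le_cos (x := θ)
  nlinarith

/-- **Composition (kernel-checked): the two one-sided estimates ⇒ `ArcBoundaryValues`.** [folklore] -/
theorem ArcBoundaryValues_of :
    __Registered.stub_nearArcZero → __Registered.stub_nearArcPi →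
      Summit.CriticalPhenomena.SAWScalingLimit.Theses.SAWSchrammPassage.ArcBoundaryValues := by
  intro h0 hπ e he
  have he2 : 0 < e / 2 := half_pos he
  obtain ⟨η₀, hη₀, N₀, h0'⟩ := h0 (e / 2) he2
  obtain ⟨η₁, hη₁, N₁, h1'⟩ := hπ (e / 2) he2
  refine ⟨min (min η₀ η₁) (min 1 e), lt_min (lt_min hη₀ hη₁) (lt_min one_pos he), max N₀ N₁, ?_⟩
  intro δ S p p' q q' D Φ x L hδ hp hq hp' hq' hpp' hqq' hcar hpt0 hpt1 hΦ hx hroom harg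
  have hN₀ : (N₀ : ℝ) * δ ≤ Metric.infDist x D.carrierᶜ :=
    le_trans (mul_le_mul_of_nonneg_right (by exact_mod_cast le_max_left N₀ N₁) hδ.le) hroom
  have hN₁ : (N₁ : ℝ) * δ ≤ Metric.infDist x D.carrierᶜ :=
    le_trans (mul_le_mul_of_nonneg_right (by exact_mod_cast le_max_right N₀ N₁) hδ.le) hroom
  -- the uniformizing coordinate lies in the upper half plane
  have him : 0 < (Φ.symm x).im := by
    have hw := Φ.symm_mapsTo hx
    simpa [UpperHalfPlane.upperHalfPlaneSet] using hw
  have hw0 : (Φ.symm x : ℂ) ≠ 0 := fun h => by rw [h] at him; simp at him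
  have hcos : (Φ.symm x).re / ‖(Φ.symm x : ℂ)‖ = Real.cos (Complex.arg (Φ.symm x)) :=
    (Complex.cos_arg hw0).symm
  have harg0 : 0 ≤ Complex.arg (Φ.symm x) := Complex.arg_nonneg_iff.2 him.le
  have hargπ : Complex.arg (Φ.symm x) ≤ Real.pi := Complex.arg_le_pi _
  -- the Jordan index of an interior point is ±1
  have hι : (D.index x : ℝ) = 1 ∨ (D.index x : ℝ) = -1 := by
    rcases D.toJordanDomain.index_eq_one_or_eq_neg_one hx with h | h
    · left; exact_mod_cast h
    · right; exact_mod_cast h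
  set hv : ℝ := (SAW.law D.carrier δ p q {γ | wind (fun t => L γ t - x) ≠ 0}).toReal with hhv
  rcases harg with harg | harg
  · -- `x` adjacent to the arc `Φ(ℝ₊)`
    have hθ : Complex.arg (Φ.symm x) ≤ η₀ := harg.trans ((min_le_left _ _).trans (min_le_left _ _))
    have hmain : |hv - (1 - (D.index x : ℝ)) / 2| ≤ e / 2 :=
      h0' δ S p p' q q' D Φ x hδ hp hq hp' hq' hpp' hqq' hcar hpt0 hpt1 hΦ hx hN₀ hθ
    have hc : 1 - Real.cos (Complex.arg (Φ.symm x)) ≤ e := by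
      refine one_sub_cos_le he ?_
      rw [abs_of_nonneg harg0]
      exact harg.trans (min_le_right _ _)
    have hc0 : 0 ≤ 1 - Real.cos (Complex.arg (Φ.symm x)) := sub_nonneg.2 (Real.cos_le_one _)
    have htrig : |(1 - (D.index x : ℝ)) / 2 - (1 - (D.index x : ℝ) * ((Φ.symm x).re / ‖(Φ.symm x : ℂ)‖)) / 2| ≤ e / 2 := by
      rw [hcos]
      rcases hι with h | h <;> rw [h]
      · rw [show (1 - (1 : ℝ)) / 2 - (1 - 1 * Real.cos (Complex.arg (Φ.symm x))) / 2 =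
            -((1 - Real.cos (Complex.arg (Φ.symm x))) / 2) by ring, abs_neg, abs_of_nonneg (by linarith)]
        linarith
      · rw [show (1 - (-1 : ℝ)) / 2 - (1 - -1 * Real.cos (Complex.arg (Φ.symm x))) / 2 =
            (1 - Real.cos (Complex.arg (Φ.symm x))) / 2 by ring, abs_of_nonneg (by linarith)]
        linarith
    calc |hv - (1 - (D.index x : ℝ) * ((Φ.symm x).re / ‖(Φ.symm x : ℂ)‖)) / 2|
        ≤ |hv - (1 - (D.index x : ℝ)) / 2| +
          |(1 - (D.index x : ℝ)) / 2 - (1 - (D.index x : ℝ) * ((Φ.symm x).re / ‖(Φ.symm x : ℂ)‖)) / 2| :=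
          abs_sub_le _ _ _
      _ ≤ e / 2 + e / 2 := add_le_add hmain htrig
      _ = e := by ring
  · -- `x` adjacent to the arc `Φ(ℝ₋)`
    have hθ : Real.pi - η₁ ≤ Complex.arg (Φ.symm x) :=
      le_trans (sub_le_sub_left ((min_le_left _ _).trans (min_le_right _ _)) _) harg
    have hmain : |hv - (1 + (D.index x : ℝ)) / 2| ≤ e / 2 :=
      h1' δ S p p' q q' D Φ x hδ hp hq hp' hq' hpp' hqq' hcar hpt0 hpt1 hΦ hx hN₁ hθ
    have hc : 1 + Real.cos (Complex.arg (Φ.symm x)) ≤ e := by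
      have : 1 - Real.cos (Real.pi - Complex.arg (Φ.symm x)) ≤ e := by
        refine one_sub_cos_le he ?_
        rw [abs_of_nonneg (by linarith)]
        linarith [min_le_right (min η₀ η₁) (min 1 e)]
      rwa [Real.cos_pi_sub, sub_neg_eq_add] at this
    have hc0 : 0 ≤ 1 + Real.cos (Complex.arg (Φ.symm x)) := by linarith [Real.neg_one_le_cos (Complex.arg (Φ.symm x))]
    have htrig : |(1 + (D.index x : ℝ)) / 2 - (1 - (D.index x : ℝ) * ((Φ.symm x).re / ‖(Φ.symm x : ℂ)‖)) / 2| ≤ e / 2 := by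
      rw [hcos]
      rcases hι with h | h <;> rw [h]
      · rw [show (1 + (1 : ℝ)) / 2 - (1 - 1 * Real.cos (Complex.arg (Φ.symm x))) / 2 =
            (1 + Real.cos (Complex.arg (Φ.symm x))) / 2 by ring, abs_of_nonneg (by linarith)]
        linarith
      · rw [show (1 + (-1 : ℝ)) / 2 - (1 - -1 * Real.cos (Complex.arg (Φ.symm x))) / 2 =
            -((1 + Real.cos (Complex.arg (Φ.symm x))) / 2) by ring, abs_neg, abs_of_nonneg (by linarith)]
        linarith
    calc |hv - (1 - (D.index x : ℝ) * ((Φ.symm x).re / ‖(Φ.symm x : ℂ)‖)) / 2|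
        ≤ |hv - (1 + (D.index x : ℝ)) / 2| +
          |(1 + (D.index x : ℝ)) / 2 - (1 - (D.index x : ℝ) * ((Φ.symm x).re / ‖(Φ.symm x : ℂ)‖)) / 2| :=
          abs_sub_le _ _ _
      _ ≤ e / 2 + e / 2 := add_le_add hmain htrig
      _ = e := by ring

/-- WIRING CHECK (an `example`: no pre-composed witness enters the environment). -/
example : Summit.CriticalPhenomena.SAWScalingLimit.Theses.SAWSchrammPassage.ArcBoundaryValues :=
  ArcBoundaryValues_of stub_nearArcZero stub_nearArcPi

end Summit.CriticalPhenomena.SAWScalingLimit.Cruxes.ArcBoundaryValues.Birth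

end
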